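import Mathlib
import HarnessLib
import Literature.Analysis.FluidPDE.SelfSimilar

/-!
# Glue lemmas of line decaying-ancient-bridge (crux `RellichScar.ApexLocalisation`)

Two elementary lemmas used by the composition of the line (stmt-NavierStokesRegularity-11719):

* `shiftedDecay_of_bounds` — the bound `‖N‖ ≤ B`, the Type-I rate `‖N‖ ≤ C/√(-t)`
  (`Literature.Analysis.FluidPDE.HasTypeITimeDecay`) and the KNSS spatial bound `‖y‖ ‖N‖ ≤ K` combine
  into the shifted space–time decay `‖N(t,y)‖ ≤ (B + C + K)/(1 + ‖y‖ + √(-t))` (the input of the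
  ⇐ transfer `stub_apexOfDecaying`);
* `not_ae_eq_zero_of_continuousOn` — a field continuous on the open slab `(-∞,0) × ℝ³` which does not
  vanish at one point of the slab is not a.e. zero there.

Real analysis only; no definitions.
-/

-- the summit and its single sub-problem share the name (CONVENTIONS §1), as in every Theorems file
set_option linter.dupNamespace false

namespace Summit.NavierStokesRegularity.NavierStokesRegularity.Theorems.RellichScarApexLocalisation

open MeasureTheory Set Function Metric Filter Topology TopologicalSpace
open scoped ENNReal NNReal
open Literature.Analysis Literature.Analysis.FluidPDE

/-- Glue: the three bounds `‖N‖ ≤ B`, `‖N‖ ≤ C/√(-t)` and `‖y‖ ‖N‖ ≤ K` combine into the shifted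
space–time decay `‖N(t,y)‖ ≤ (B + C + K)/(1 + ‖y‖ + √(-t))`. -/
theorem shiftedDecay_of_bounds {N : ℝ → (EuclideanSpace ℝ (Fin 3)) → (EuclideanSpace ℝ (Fin 3))} {B C K : ℝ}
    (hB : ∀ t < 0, ∀ x : (EuclideanSpace ℝ (Fin 3)), ‖N t x‖ ≤ B) (hC : HasTypeITimeDecay C N)
    (hK : ∀ s < 0, ∀ y : (EuclideanSpace ℝ (Fin 3)), ‖y‖ * ‖N s y‖ ≤ K) :
    ∀ t : ℝ, t < 0 → ∀ x : (EuclideanSpace ℝ (Fin 3)), ‖N t x‖ ≤ (B + C + K) / (1 + ‖x‖ + Real.sqrt (-t)) := by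
  intro t ht x
  have hs : 0 < Real.sqrt (-t) := Real.sqrt_pos.2 (by linarith)
  have hden : 0 < 1 + ‖x‖ + Real.sqrt (-t) := by positivity
  rw [le_div_iff₀ hden]
  have h1 := hB t ht x
  have h2 : Real.sqrt (-t) * ‖N t x‖ ≤ C := by
    have := hC t ht x
    rwa [le_div_iff₀ hs, mul_comm] at this
  have h3 := hK t ht x
  nlinarith [norm_nonneg (N t x), norm_nonneg x]

/-- Glue: a field continuous on the open slab which does not vanish at some point of the slab is not
a.e. zero there (the non-vanishing set is a non-empty open set, of positive Lebesgue measure). -/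
theorem not_ae_eq_zero_of_continuousOn {N : ℝ → (EuclideanSpace ℝ (Fin 3)) → (EuclideanSpace ℝ (Fin 3))}
    (hcont : ContinuousOn (uncurry N) (Iio (0 : ℝ) ×ˢ univ)) {s : ℝ} (hs : s < 0) {y : (EuclideanSpace ℝ (Fin 3))}
    (hy : N s y ≠ 0) :
    ¬ (uncurry N =ᵐ[volume.restrict (Iio (0 : ℝ) ×ˢ (univ : Set (EuclideanSpace ℝ (Fin 3))))] 0) := by
  intro h
  have hSopen : IsOpen (Iio (0 : ℝ) ×ˢ (univ : Set (EuclideanSpace ℝ (Fin 3)))) := isOpen_Iio.prod isOpen_univ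
  have hUopen : IsOpen ((Iio (0 : ℝ) ×ˢ (univ : Set (EuclideanSpace ℝ (Fin 3)))) ∩ (uncurry N) ⁻¹' ({0}ᶜ)) :=
    hcont.isOpen_inter_preimage hSopen isOpen_compl_singleton
  have hmem : ((s, y) : ℝ × (EuclideanSpace ℝ (Fin 3))) ∈ (Iio (0 : ℝ) ×ˢ (univ : Set (EuclideanSpace ℝ (Fin 3)))) ∩ (uncurry N) ⁻¹' ({0}ᶜ) :=
    ⟨⟨hs, mem_univ _⟩, hy⟩
  have hpos : 0 < volume ((Iio (0 : ℝ) ×ˢ (univ : Set (EuclideanSpace ℝ (Fin 3)))) ∩ (uncurry N) ⁻¹' ({0}ᶜ)) :=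
    hUopen.measure_pos volume ⟨(s, y), hmem⟩
  have hzero : volume.restrict (Iio (0 : ℝ) ×ˢ (univ : Set (EuclideanSpace ℝ (Fin 3)))) ((uncurry N) ⁻¹' ({0}ᶜ)) = 0 := by
    have h' : ∀ᵐ z ∂(volume.restrict (Iio (0 : ℝ) ×ˢ (univ : Set (EuclideanSpace ℝ (Fin 3))))), z ∉ (uncurry N) ⁻¹' ({0}ᶜ) := by
      filter_upwards [h] with z hz
      simp [hz]
    exact measure_eq_zero_iff_ae_notMem.2 h'
  rw [Measure.restrict_apply' hSopen.measurableSet, inter_comm] at hzero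
  exact hpos.ne' hzero

end Summit.NavierStokesRegularity.NavierStokesRegularity.Theorems.RellichScarApexLocalisation
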